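import Literature.Geometry.Riemannian.AlmostNonnegativeCurvatureSmoothingProofs
import Literature.Geometry.Lorentzian.IsometryProofs
import Literature.Geometry.Lorentzian.LeviCivitaProofs
import Literature.Geometry.Lorentzian.ChartMetricCoord
import Literature.Geometry.Riemannian.QuotientMetric
import Literature.Geometry.Riemannian.IsotropicCurvature
import Literature.Geometry.Manifold.InverseFunctionTheorem
import HarnessLib

/-!
# Transport of metrics and curvature along local diffeomorphisms; metrics on chart domains

Support file (everything proved; no named fact, no `sorry`) for the Gromov–Thurston `2π`
theorem `Literature.Geometry.Riemannian.gromovThurston_twoPi_four` (`CuspedHyperbolic.lean`),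
whose metric on the Dehn filling `P` is assembled from model metrics (the hyperbolic metric of
the thick part, the smoothed cusp model, the flat core model) pushed forward along local
diffeomorphisms (the embedding of the thick part, the cusp parametrisation, the filling-piece
parametrisation). Three generic tools:

* **Smoothness descends along local diffeomorphisms** (`contMDiffAt_of_pullbackBilin_eq`): a
  field `s` of bilinear forms on `TP` whose pullback along a map `f : N → P`, smooth near `u₀`
  with injective differential at `u₀` (same model space), agrees near `u₀` with a smooth metric
  `gN` of `N`, is smooth at `f u₀` — near `f u₀` it is the pullback of `gN` along a smooth local
  inverse of `f` (inverse function theorem, `isLocalDiffeomorphAt_of_mfderiv`; O'Neill 1983, Ch. 3,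
  pp. 90–91: "a local diffeomorphism onto a semi-Riemannian manifold pulls back a unique metric
  making it a local isometry", read backwards). Pointwise companions: `symm_of_pullback_eq`,
  `pos_of_pullback_eq`, `nonpos_of_pullback_eq₄`.
* **Naturality of `Rm`** (`curvatureForm_eq_of_val_eq`, from the tree's
  `PseudoRiemannianMetric.curvatureForm_comap_leviCivita`): for an
  equidimensional immersion `Φ : (N, Φ^*g) → (M, g)`,
  `Rm^{Φ^*g}_u(X, Y, Z, W) = Rm^g_{Φ u}(dΦ X, dΦ Y, dΦ Z, dΦ W)` (O'Neill 1983, Ch. 3,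
  Prop. 3.59); in particular the sign of the sectional curvatures is preserved.
* **Metrics on chart domains from components** (`riemannianOfRepr`) — a smooth,
  symmetric, positive definite field `G : E → E →L E →L ℝ` on `V : Opens E` is a Riemannian
  `PseudoRiemannianMetric` on `V` — and **continuity of `Rm` in the base point on a chart
  domain** (`continuousOn_apply_riemAt`, from the smoothness of the Christoffel map),
  used to extend a curvature sign over a nowhere dense set (the core torus):
  `curvatureForm_nonpos_of_dense`.

## References

* B. O'Neill, *Semi-Riemannian geometry with applications to relativity*, Academic Press 1983,
  Ch. 3, Def. 3.9, Lemma 3.38, Prop. 3.59, pp. 90–91. [ONeill1983]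
* J. M. Lee, *Introduction to Smooth Manifolds*, 2nd ed. (2013), Thm. 4.5. [LeeSmoothManifolds2013]
-/

noncomputable section

open Bundle Set Function Filter TopologicalSpace
open scoped Manifold ContDiff Topology

namespace Literature.Geometry.Riemannian

open Literature.Geometry.Lorentzian Literature.Geometry.Lorentzian.PseudoRiemannianMetric
  Literature.Geometry.Manifold Literature.Geometry.Lorentzian.OpensChart

/-! ### Pointwise transport through an invertible differential -/

section Pointwise

variable {E : Type*} [NormedAddCommGroup E] [NormedSpace ℝ E] [FiniteDimensional ℝ E]
  {H : Type*} [TopologicalSpace H] {I : ModelWithCorners ℝ E H}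
  {H' : Type*} [TopologicalSpace H'] {J : ModelWithCorners ℝ E H'}
  {N : Type*} [TopologicalSpace N] [ChartedSpace H N]
  {P : Type*} [TopologicalSpace P] [ChartedSpace H' P]

/-- **Symmetry transports**: if `s_{f u}(df v, df w) = b(v, w)` for a symmetric `b` and `df_u` is
injective (hence onto, equal model dimension), then `s_{f u}` is symmetric. [folklore] -/
theorem symm_of_pullback_eq {f : N → P} {u : N} (hf' : Injective (mfderiv I J f u))
    {s : TangentSpace J (f u) →L[ℝ] TangentSpace J (f u) →L[ℝ] ℝ}
    {b : TangentSpace I u →L[ℝ] TangentSpace I u →L[ℝ] ℝ} (hb : ∀ v w, b v w = b w v)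
    (heq : ∀ v w, s (mfderiv I J f u v) (mfderiv I J f u w) = b v w)
    (v w : TangentSpace J (f u)) : s v w = s w v := by
  have hsurj := (mfderiv_bijective_of_injective hf' rfl).2
  obtain ⟨v', rfl⟩ := hsurj v
  obtain ⟨w', rfl⟩ := hsurj w
  rw [heq, heq, hb]

/-- **Positivity transports**: if `s_{f u}(df v, df w) = b(v, w)` for a positive definite `b`
and `df_u` is injective, then `s_{f u}` is positive definite. [folklore] -/
theorem pos_of_pullback_eq {f : N → P} {u : N} (hf' : Injective (mfderiv I J f u))
    {s : TangentSpace J (f u) →L[ℝ] TangentSpace J (f u) →L[ℝ] ℝ}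
    {b : TangentSpace I u →L[ℝ] TangentSpace I u →L[ℝ] ℝ} (hb : ∀ v, v ≠ 0 → 0 < b v v)
    (heq : ∀ v w, s (mfderiv I J f u v) (mfderiv I J f u w) = b v w)
    (v : TangentSpace J (f u)) (hv : v ≠ 0) : 0 < s v v := by
  have hsurj := (mfderiv_bijective_of_injective hf' rfl).2
  obtain ⟨v', rfl⟩ := hsurj v
  rw [heq]
  refine hb v' fun h ↦ hv ?_
  rw [h, map_zero]

/-- **A sign transports** through an onto differential: if
`t(df v, df w, df x, df y) = r(v, w, x, y)` and `r(v, w, w, v) ≤ 0` for all `v, w`, then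
`t(v, w, w, v) ≤ 0` for all `v, w` (the sectional-curvature numerator shape). [folklore] -/
theorem nonpos_of_pullback_eq₄ {f : N → P} {u : N} (hf' : Injective (mfderiv I J f u))
    {t : TangentSpace J (f u) → TangentSpace J (f u) → TangentSpace J (f u) →
      TangentSpace J (f u) → ℝ}
    {r : TangentSpace I u → TangentSpace I u → TangentSpace I u → TangentSpace I u → ℝ}
    (hr : ∀ v w, r v w w v ≤ 0)
    (heq : ∀ v w x y, t (mfderiv I J f u v) (mfderiv I J f u w) (mfderiv I J f u x)
      (mfderiv I J f u y) = r v w x y)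
    (v w : TangentSpace J (f u)) : t v w w v ≤ 0 := by
  have hsurj := (mfderiv_bijective_of_injective hf' rfl).2
  obtain ⟨v', rfl⟩ := hsurj v
  obtain ⟨w', rfl⟩ := hsurj w
  rw [heq]
  exact hr v' w'

end Pointwise

/-! ### Smoothness descends along local diffeomorphisms -/

section Descent

variable {E : Type*} [NormedAddCommGroup E] [NormedSpace ℝ E] [FiniteDimensional ℝ E]
  [CompleteSpace E]
  {H : Type*} [TopologicalSpace H] {I : ModelWithCorners ℝ E H} [I.Boundaryless]
  {H' : Type*} [TopologicalSpace H'] {J : ModelWithCorners ℝ E H'} [J.Boundaryless]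
  {N : Type*} [TopologicalSpace N] [ChartedSpace H N] [IsManifold I ∞ N]
  {P : Type*} [TopologicalSpace P] [ChartedSpace H' P] [IsManifold J ∞ P]

/-- A map which is `C^∞` on an open set `O ∋ u₀` with injective differential at `u₀` (same model
space) is a local diffeomorphism at `u₀` (inverse function theorem,
`isLocalDiffeomorphAt_of_mfderiv`). [cite: LeeSmoothManifolds2013, Thm. 4.5] -/
theorem isLocalDiffeomorphAt_of_injective {f : N → P} {u₀ : N} {O : Set N} (hO : IsOpen O)
    (hu₀ : u₀ ∈ O) (hf : ContMDiffOn I J ∞ f O) (hf' : Injective (mfderiv I J f u₀)) :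
    IsLocalDiffeomorphAt I J ∞ f u₀ := by
  haveI : FiniteDimensional ℝ (TangentSpace I u₀) := inferInstanceAs (FiniteDimensional ℝ E)
  haveI : FiniteDimensional ℝ (TangentSpace J (f u₀)) := inferInstanceAs (FiniteDimensional ℝ E)
  haveI : T2Space (TangentSpace I u₀) := inferInstanceAs (T2Space E)
  haveI : T2Space (TangentSpace J (f u₀)) := inferInstanceAs (T2Space E)
  refine isLocalDiffeomorphAt_of_mfderiv (by simp) hO hu₀ hf
    ((mfderivEquivOfInjective (I := J) (I' := I) f u₀ hf' rfl).toContinuousLinearEquiv) ?_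
  ext v
  rfl

/-- **Smoothness of a field of bilinear forms descends along a local diffeomorphism.** Let
`gN` be a `C^∞` metric on `N`, `s` a field of bilinear forms on `TP`, and `f : N → P` a map
which is `C^∞` on an open set `O ∋ u₀` with injective differential `df_{u₀}` (same model space).
If the pullback `f^* s` agrees with `gN` near `u₀`, then `s` is `C^∞` at `f u₀` as a section of
`Hom(TP, Hom(TP, ℝ))`: near `f u₀`, `s = σ^* gN` for a smooth local inverse `σ` of `f`
(O'Neill 1983, Ch. 3, pp. 90–91; inverse function theorem, Lee 2013, Thm. 4.5).
[cite: ONeill1983, Ch. 3, pp. 90–91] -/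
theorem contMDiffAt_of_pullbackBilin_eq
    (gN : PseudoRiemannianMetric I ∞ E (TangentSpace I : N → Type _))
    (s : Π p : P, TangentSpace J p →L[ℝ] TangentSpace J p →L[ℝ] ℝ)
    {f : N → P} {u₀ : N} {O : Set N} (hO : IsOpen O) (hu₀ : u₀ ∈ O)
    (hf : ContMDiffOn I J ∞ f O) (hf' : Injective (mfderiv I J f u₀))
    (heq : ∀ᶠ u in 𝓝 u₀, pullbackBilin (I := J) (I' := I) f s u = gN.val u) :
    ContMDiffAt J (J.prod 𝓘(ℝ, E →L[ℝ] E →L[ℝ] ℝ)) ∞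
      (fun p : P ↦ TotalSpace.mk' (E →L[ℝ] E →L[ℝ] ℝ)
        (E := fun p : P ↦ TangentSpace J p →L[ℝ] TangentSpace J p →L[ℝ] ℝ) p (s p)) (f u₀) := by
  have hloc : IsLocalDiffeomorphAt I J ∞ f u₀ := isLocalDiffeomorphAt_of_injective hO hu₀ hf hf'
  set σ := hloc.localInverse with hσ
  have hσu : σ (f u₀) = u₀ := hloc.localInverse_left_inv hloc.localInverse_mem_target
  have hσc : ContMDiffAt J I ∞ σ (f u₀) := hloc.localInverse_contMDiffAt
  -- `f` is differentiable near `u₀`, `σ` near `f u₀`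
  have hfd : ∀ᶠ u in 𝓝 u₀, MDifferentiableAt I J f u := by
    filter_upwards [hO.mem_nhds hu₀] with u hu
    exact (hf.contMDiffAt (hO.mem_nhds hu)).mdifferentiableAt (by simp)
  have hσd : ∀ᶠ p in 𝓝 (f u₀), MDifferentiableAt J I σ p := by
    filter_upwards [hloc.localInverse.open_source.mem_nhds hloc.localInverse_mem_source]
      with p hp
    exact (hloc.localInverse_contMDiffOn.contMDiffAt
      (hloc.localInverse.open_source.mem_nhds hp)).mdifferentiableAt (by simp)
  -- near `f u₀`: `s = σ^* gN`
  have hσt : Tendsto σ (𝓝 (f u₀)) (𝓝 u₀) := by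
    have h := hσc.continuousAt
    rw [ContinuousAt, hσu] at h
    exact h
  have hkey : ∀ᶠ p in 𝓝 (f u₀), s p = pullbackBilin (I := I) (I' := J) σ gN.val p := by
    have h1 : ∀ᶠ p in 𝓝 (f u₀), pullbackBilin (I := J) (I' := I) f s (σ p) = gN.val (σ p) :=
      hσt.eventually heq
    have h2 : ∀ᶠ p in 𝓝 (f u₀), MDifferentiableAt I J f (σ p) := hσt.eventually hfd
    have h3 : ∀ᶠ p in 𝓝 (f u₀), f ∘ σ =ᶠ[𝓝 p] id :=
      hloc.localInverse_eventuallyEq_right.eventuallyEq_nhds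
    filter_upwards [h1, h2, hσd, h3] with p h1 h2 h3 h4
    have hp : f (σ p) = p := by simpa using h4.self_of_nhds
    have hcomp : (mfderiv I J f (σ p)).comp (mfderiv J I σ p) =
        ContinuousLinearMap.id ℝ (TangentSpace J p) := by
      rw [← mfderiv_comp p h2 h3, h4.mfderiv_eq, mfderiv_id]
    have hvw : ∀ v : TangentSpace J p,
        mfderiv I J f (σ p) (mfderiv J I σ p v) = (ContinuousLinearMap.id ℝ (TangentSpace J p)) v :=
      fun v ↦ by rw [← hcomp]; rfl
    ext v w
    rw [pullbackBilin_apply, ← h1, pullbackBilin_apply, hvw, hvw, ContinuousLinearMap.coe_id',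
      id_eq, id_eq, hp]
  -- `σ^* gN` is smooth at `f u₀`
  have hsm := contMDiffAt_pullbackBilin (I := I) (I' := J) (f := σ) (y₀ := f u₀) (n := ∞)
    (show ContMDiffAt J I (∞ + 1) σ (f u₀) from hσc) gN
  refine hsm.congr_of_eventuallyEq ?_
  filter_upwards [hkey] with p hp
  rw [hp]

end Descent

/-! ### Naturality of the covariant curvature tensor -/

section Naturality

variable {E : Type*} [NormedAddCommGroup E] [NormedSpace ℝ E] {H : Type*} [TopologicalSpace H]
  {I : ModelWithCorners ℝ E H} {M : Type*} [TopologicalSpace M] [ChartedSpace H M]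
  [IsManifold I ∞ M]
  {E' : Type*} [NormedAddCommGroup E'] [NormedSpace ℝ E'] {H' : Type*} [TopologicalSpace H']
  {I' : ModelWithCorners ℝ E' H'} {N : Type*} [TopologicalSpace N] [ChartedSpace H' N]
  [IsManifold I' ∞ N]
  [FiniteDimensional ℝ E] [FiniteDimensional ℝ E'] [CompleteSpace E] [CompleteSpace E']
  (g : PseudoRiemannianMetric I ∞ E (TangentSpace I : M → Type _))
  {Φ : N → M} (hΦ : ContMDiff I' I (∞ + 1) Φ)
  (hΦ' : ∀ u, Function.Injective (mfderiv I' I Φ u))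
  (hdim : Module.finrank ℝ E' = Module.finrank ℝ E)

include hΦ hΦ' hdim in
/-- **Naturality of `Rm`, for a metric isometric through `Φ`.** If `gN` is a smooth metric on
`N` with `gN_u(v, w) = g_{Φ u}(dΦ v, dΦ w)` for all `u, v, w` (i.e. `gN = Φ^* g`; `Φ` a smooth
equidimensional immersion), then for the Levi-Civita connections
`Rm^{gN}_u(X, Y, Z, W) = Rm^g_{Φ u}(dΦ X, dΦ Y, dΦ Z, dΦ W)`. [cite: ONeill1983, Ch. 3, Prop. 3.59] -/
theorem curvatureForm_eq_of_val_eq (gN : PseudoRiemannianMetric I' ∞ E' (TangentSpace I' : N → Type _))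
    (hval : ∀ (u : N) (v w : TangentSpace I' u),
      gN.val u v w = g.val (Φ u) (mfderiv I' I Φ u v) (mfderiv I' I Φ u w))
    [gN.HasLeviCivita] [g.HasLeviCivita] (u : N) (X Y Z W : TangentSpace I' u) :
    gN.curvatureForm gN.leviCivita u X Y Z W =
      g.curvatureForm g.leviCivita (Φ u) (mfderiv I' I Φ u X) (mfderiv I' I Φ u Y)
        (mfderiv I' I Φ u Z) (mfderiv I' I Φ u W) := by
  have hpb : contMDiff_pullbackBilin I M I' N ∞ := contMDiff_pullbackBilin_holds
  have hgN : gN = g.comap hpb Φ hΦ hΦ' hdim := by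
    ext u v w
    rw [hval, val_comap, pullbackBilin_apply]
  subst hgN
  exact g.curvatureForm_comap_leviCivita hpb hΦ hΦ' hdim u X Y Z W

end Naturality

/-! ### Metrics on chart domains from components; continuity of `Rm` in the base point -/

section OpensChart

variable {E : Type*} [NormedAddCommGroup E] [NormedSpace ℝ E] [FiniteDimensional ℝ E]
  [CompleteSpace E]

/-- **The Riemannian metric on a chart domain with prescribed components.** A field
`G : E → E →L E →L ℝ` of bilinear forms which is `C^∞` on the open set `V`, symmetric and
positive definite there, is a `C^∞` Riemannian `PseudoRiemannianMetric` on the open submanifold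
`V : Opens E` (O'Neill 1983, Ch. 3, Def. 3.1: a metric tensor in coordinates).
[cite: ONeill1983, Ch. 3, Def. 3.1] -/
def riemannianOfRepr (V : Opens E) (G : E → E →L[ℝ] E →L[ℝ] ℝ) (hG : ContDiffOn ℝ ∞ G V)
    (hsymm : ∀ y ∈ (V : Set E), ∀ v w, G y v w = G y w v)
    (hpos : ∀ y ∈ (V : Set E), ∀ v, v ≠ 0 → 0 < G y v v) :
    PseudoRiemannianMetric 𝓘(ℝ, E) ∞ E (TangentSpace 𝓘(ℝ, E) : V → Type _) where
  val y := G y.1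
  symm y v w := hsymm y.1 y.2 v w
  nondegenerate y v hv := by
    by_contra h
    exact (hpos y.1 y.2 v h).ne' (hv v)
  contMDiff y :=
    (contMDiffAt_bilinSection_iff y _ G (fun _ ↦ rfl)).2 (hG.contDiffAt (V.2.mem_nhds y.2))

variable {V : Opens E} {G : E → E →L[ℝ] E →L[ℝ] ℝ} {hG : ContDiffOn ℝ ∞ G V}
  {hsymm : ∀ y ∈ (V : Set E), ∀ v w, G y v w = G y w v}
  {hpos : ∀ y ∈ (V : Set E), ∀ v, v ≠ 0 → 0 < G y v v}

omit [FiniteDimensional ℝ E] [CompleteSpace E] in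
/-- The value of `riemannianOfRepr` is `G`. [folklore] -/
@[simp]
theorem riemannianOfRepr_val (y : V) : (riemannianOfRepr V G hG hsymm hpos).val y = G y.1 := rfl

omit [FiniteDimensional ℝ E] [CompleteSpace E] in
/-- `riemannianOfRepr` is Riemannian. [folklore] -/
theorem isRiemannian_riemannianOfRepr : (riemannianOfRepr V G hG hsymm hpos).IsRiemannian :=
  fun y v hv ↦ hpos y.1 y.2 v hv

omit [FiniteDimensional ℝ E] in
/-- **`Rm` of a chart-domain metric is continuous in the base point**: for a representative `G`
of a smooth metric on `V` (`MetricCoord.IsMetricOn G V`) and fixed vectors `X, Y, Z, W`, the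
function `y ↦ G_y(riemAt G y X Y Z, W)` is continuous on `V` (the Christoffel map is `C^∞` on
`V`, `IsMetricOn.contDiffOn_chrAt`, hence so is its derivative; O'Neill 1983, Ch. 3, Lemma 3.38).
[cite: ONeill1983, Ch. 3, Lemma 3.38] -/
theorem continuousOn_apply_riemAt {G : E → E →L[ℝ] E →L[ℝ] ℝ} {V : Set E}
    (hGm : MetricCoord.IsMetricOn G V) (X Y Z W : E) :
    ContinuousOn (fun y ↦ G y (MetricCoord.riemAt G y X Y Z) W) V := by
  have hΓ : ContDiffOn ℝ ∞ (MetricCoord.chrAt G) V := hGm.contDiffOn_chrAt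
  have hΓc : ContinuousOn (MetricCoord.chrAt G) V := hΓ.continuousOn
  have hdΓ : ContinuousOn (fderiv ℝ (MetricCoord.chrAt G)) V :=
    hΓ.continuousOn_fderiv_of_isOpen hGm.isOpen (by simp)
  have hGc : ContinuousOn G V := hGm.contDiffOn.continuousOn
  have hR : ContinuousOn (fun y ↦ MetricCoord.riemAt G y X Y Z) V := by
    have h1 : ContinuousOn (fun y ↦ fderiv ℝ (MetricCoord.chrAt G) y X Y Z) V :=
      ((ContinuousLinearMap.apply ℝ _ Z).continuous.comp_continuousOn
        ((ContinuousLinearMap.apply ℝ _ Y).continuous.comp_continuousOn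
          ((ContinuousLinearMap.apply ℝ _ X).continuous.comp_continuousOn hdΓ)))
    have h2 : ContinuousOn (fun y ↦ fderiv ℝ (MetricCoord.chrAt G) y Y X Z) V :=
      ((ContinuousLinearMap.apply ℝ _ Z).continuous.comp_continuousOn
        ((ContinuousLinearMap.apply ℝ _ X).continuous.comp_continuousOn
          ((ContinuousLinearMap.apply ℝ _ Y).continuous.comp_continuousOn hdΓ)))
    have hev : ∀ A B : E, ContinuousOn (fun y ↦ MetricCoord.chrAt G y A B) V := fun A B ↦
      ((ContinuousLinearMap.apply ℝ _ B).continuous.comp_continuousOn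
        ((ContinuousLinearMap.apply ℝ _ A).continuous.comp_continuousOn hΓc))
    have h3 : ContinuousOn (fun y ↦ MetricCoord.chrAt G y X (MetricCoord.chrAt G y Y Z)) V := by
      have hpair : ContinuousOn (fun y ↦ (MetricCoord.chrAt G y X, MetricCoord.chrAt G y Y Z)) V :=
        ((ContinuousLinearMap.apply ℝ _ X).continuous.comp_continuousOn hΓc).prodMk (hev Y Z)
      exact (isBoundedBilinearMap_apply (𝕜 := ℝ) (E := E) (F := E)).continuous.comp_continuousOn
        hpair
    have h4 : ContinuousOn (fun y ↦ MetricCoord.chrAt G y Y (MetricCoord.chrAt G y X Z)) V := by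
      have hpair : ContinuousOn (fun y ↦ (MetricCoord.chrAt G y Y, MetricCoord.chrAt G y X Z)) V :=
        ((ContinuousLinearMap.apply ℝ _ Y).continuous.comp_continuousOn hΓc).prodMk (hev X Z)
      exact (isBoundedBilinearMap_apply (𝕜 := ℝ) (E := E) (F := E)).continuous.comp_continuousOn
        hpair
    have := ((h1.sub h2).add h3).sub h4
    refine this.congr fun y _ ↦ ?_
    simp only [MetricCoord.riemAt_apply, Pi.add_apply, Pi.sub_apply]
  have hpair : ContinuousOn (fun y ↦ (G y, MetricCoord.riemAt G y X Y Z)) V := hGc.prodMk hR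
  have h5 : ContinuousOn (fun y ↦ G y (MetricCoord.riemAt G y X Y Z)) V :=
    (isBoundedBilinearMap_apply (𝕜 := ℝ) (E := E) (F := E →L[ℝ] ℝ)).continuous.comp_continuousOn
      hpair
  exact (ContinuousLinearMap.apply ℝ _ W).continuous.comp_continuousOn h5

/-- **A curvature sign extends over a nowhere dense set.** For a smooth metric `g` on
`V : Opens E` with representative `G`, if `Rm(Y, Z, Z, Y) ≤ 0` at all points of a subset `D`
of `V` which is dense in `V`, then `Rm(Y, Z, Z, Y) ≤ 0` everywhere on `V` (continuity of `Rm` in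
the base point, `continuousOn_apply_riemAt`, and `riemann_eq_riemAt`). [folklore] -/
theorem curvatureForm_nonpos_of_dense
    {g : PseudoRiemannianMetric 𝓘(ℝ, E) ∞ E (TangentSpace 𝓘(ℝ, E) : V → Type _)}
    (hrepr : ∀ y : V, g.val y = G y) [g.HasLeviCivita] {D : Set E}
    (hD : (V : Set E) ⊆ closure D)
    (hneg : ∀ y : V, (y : E) ∈ D → ∀ Y Z : E, g.curvatureForm g.leviCivita y Y Z Z Y ≤ 0)
    (y : V) (Y Z : E) : g.curvatureForm g.leviCivita y Y Z Z Y ≤ 0 := by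
  -- `Rm(Y,Z,Z,Y)` at `y` as a function of the base point
  set φ : E → ℝ := fun x ↦ G x (MetricCoord.riemAt G x Y Z Z) Y with hφ
  have hφg : ∀ z : V, g.curvatureForm g.leviCivita z Y Z Z Y = φ z := by
    intro z
    unfold PseudoRiemannianMetric.curvatureForm
    change g.val z (g.riemann z Y Z Z) Y = φ z
    rw [riemann_eq_riemAt hrepr z Y Z Z, hrepr z]
    rfl
  have hcont : ContinuousOn φ V := continuousOn_apply_riemAt (isMetricOn_repr hrepr) Y Z Z Y
  rw [hφg]
  -- closedness of `{φ ≤ 0} ∩ V` relative to `V`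
  by_contra hlt
  rw [not_le] at hlt
  have hopen : ∀ᶠ x in 𝓝[(V : Set E)] (y : E), 0 < φ x :=
    (hcont y y.2).eventually (Ioi_mem_nhds hlt)
  have hmem : ∀ᶠ x in 𝓝[(V : Set E)] (y : E), x ∈ (V : Set E) := self_mem_nhdsWithin
  -- `D` meets every neighbourhood of `y` within `V`
  have hyD : (y : E) ∈ closure (D ∩ (V : Set E)) := by
    have : (y : E) ∈ closure D := hD y.2
    rw [mem_closure_iff_nhds] at this ⊢
    intro t ht
    have htV : t ∩ (V : Set E) ∈ 𝓝 (y : E) := inter_mem ht (V.2.mem_nhds y.2)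
    obtain ⟨x, hxt, hxD⟩ := this _ htV
    exact ⟨x, hxt.1, hxD, hxt.2⟩
  obtain ⟨t, ht, htsub⟩ : ∃ t ∈ 𝓝 (y : E), ∀ x ∈ t, x ∈ (V : Set E) → 0 < φ x := by
    rw [eventually_nhdsWithin_iff] at hopen
    exact ⟨_, hopen, fun x hx hxV ↦ hx hxV⟩
  rw [mem_closure_iff_nhds] at hyD
  obtain ⟨x, hxt, hxD, hxV⟩ := hyD t ht
  have h1 := htsub x hxt hxV
  have h2 := hneg ⟨x, hxV⟩ hxD Y Z
  rw [hφg ⟨x, hxV⟩] at h2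
  exact absurd h1 (not_lt.2 h2)

end OpensChart

end Literature.Geometry.Riemannian
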